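/-
Copyright (c) 2026 the pub-hodgecm-mathlib formalisation cell (harness21).  Prover seat hodgecm-mathlib-A-p03 (g26); road «R1LL-tree» (architect A-p16 (g27), RULING A-23 (b);
LEAD F0P3a-plan (g10)), brick (R5b-α-VERTEX) FILE V2a «the value law at the VERTEX stabiliser K♯», 2026-09-01.
-/
import Literature.NumberTheory.Automorphic.UnitaryRankTwoDepthValueLawRamified   -- ★ A-p13 α1 (EDGE twin): `apply_eq_apply_scalar_of_depth_le`, swap∕nilpotent algebra, `mul_apply_mem_integer`
import Literature.NumberTheory.Automorphic.FixedCosetsModularLatticesSep          -- ★ A-p03 V1 p843798: `mem_map_conj_glInt_iff`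
import Literature.NumberTheory.Automorphic.UnitaryGroupLevelTransport            -- ★ `unitaryGroupOfForm_smul_of_isUnit`
import HarnessLib

/-!
# The VALUE LAW at a fixed `η`-MODULAR lattice (VERTEX stabiliser `K♯ = U(J₀) ∩ D GL₂(𝒪) D⁻¹`, `D = diag(1, ϖ)`, `σϖ = −ϖ`) for an elliptic regular element of `U(1,1)`
# at a TAMELY RAMIFIED place (Labesse–Langlands 1979 §2 Lemma 2.1; Rogawski 1990 Lemma 4.9.3) — FILE V2a of (R5b-α-VERTEX)

Topic `NumberTheory/Automorphic`; namespace `Literature.NumberTheory.Automorphic`.  THEOREMS ONLY (no definition, no instance, no notation, no named fact, no `sorry`).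
Cell `pub/hodgecm-mathlib` (D-0151), crux H413 = `stmt-HodgeConjecture-24833`, road «R1-ram»∕«R1LL-tree» (architect A-p16 (g27) RULING A-23 (b)); the VERTEX twin of ★ A-p13 (g32)
α1 `UnitaryRankTwoDepthValueLawRamified` (EDGE piece), designer of record B-p12 (g29) (memo ba95cded; 10:33:18Z «`ϖ·θ♯ = −h 0`»; 10:52:58Z pins).
HONEST LABEL: HC_CM is proved only modulo the printed citations (hLiu418, h413) until rung 0 closes; this is `2 × 2` matrix algebra over a valuation ring.

THE POINT.  `D = diag(1, ϖ)` is NOT a similitude of `J₀ = [[0,1],[1,0]]` at a ramified place: `ᵗσ(D) J₀ D = (−ϖ) • J♯`, `J♯ = [[0,−1],[1,0]]` (§1).  Hence `Ad(D)` carries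
`U(σ, J♯)` onto `U(σ, J₀)` (`U((−ϖ)•J♯) = U(J♯)`), and the element `k♯ := D⁻¹ k D` attached to `k ∈ U(J₀)` is `J♯`-unitary; if `k` fixes the `η`-modular lattice `q.out·D·𝒪²`
then `k♯` is INTEGRAL, and ★ B-p12 FILE 7 `localClass_signedNormalForm_ramified_modular` puts it in the normal form `c(1 + ϖ^i N(η₀^e)) + ϖ^m R` by a `κ ∈ U(J♯)(𝒪)`, i.e. `k` in
the form `c(1 + ϖ^i · D N(η₀^e) D⁻¹)` by `DκD⁻¹ ∈ K♯`, up to a right factor of conjugated level `m`.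
* §1 `formCongr_diag_eq_neg_smul_sharp`, `conj_mem_unitary_swap_iff_mem_unitary_sharp` (`D g D⁻¹ ∈ U(J₀) ↔ g ∈ U(J♯)`), `sharp'_mul_sharp_eq_one`, `coe_inv_mul_coe_mul_eq`
  (conjugation bookkeeping `↑(D⁻¹ x D)`), `inv_conj_smul_one_add_smul_conj` (`D⁻¹(c(1 + t·DND⁻¹))D = c(1 + tN)`).
* §2 `apply_eq_apply_scalar_of_depth_le_conj` — the scalar law with the CONJUGATED level law `hKm : (∀ r s, ϖ^{−m}(↑(D⁻¹yD) − 1) r s ∈ 𝒪) → y ∈ Km`.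
* §3 **`apply_eq_apply_signedNormalForm_of_depth_eq_ramified_modular`** — the vertex value law: `Even i`, `Even (N+i+1)`, and for
  `S = (−1)^{(N+i+1)∕2+1}·c·((a−c)ϖ^{−N})·(ϖθ♯)` a bit `e ≤ 1` (`e = 0 ⟺ S̄` square) with `φ k = φ (x i e)`, `↑(x i e)⁻¹ = c⁻¹(1 − ϖ^i·D N(η₀^e) D⁻¹)`, for every `φ`
  invariant under `Ad K♯` and right-`Km`.

## References
* [LabesseLanglands1979] J.-P. Labesse, R. P. Langlands, *L-indistinguishability for SL(2)*, Canad. J. Math. 31 (1979), §2 Lemma 2.1 pp. 8–9.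
* [Rogawski1990] J. D. Rogawski, *Automorphic Representations of Unitary Groups in Three Variables* (1990), §4.9 Lemma 4.9.3 p. 56.
* [Jacobowitz1962] R. Jacobowitz, *Hermitian forms over local fields*, Amer. J. Math. 84 (1962), §8.  [Kottwitz1988] R. E. Kottwitz, *Tamagawa numbers*, §2.
-/

set_option autoImplicit false

noncomputable section

open scoped ValuativeRel Matrix MatrixGroups
open Matrix ValuativeRel

namespace Literature.NumberTheory.Automorphic

variable {F : Type*} [Field F] [ValuativeRel F]

/-! ## §1 `D = diag(1, ϖ)` versus the two forms `J₀ = antidiag(1,1)`, `J♯ = [[0,−1],[1,0]]` -/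

section Sharp

variable (σ : F →+* F) {ϖ : F} (D : GL (Fin 2) F) (hD : (D : Matrix (Fin 2) (Fin 2) F) = !![1, 0; 0, ϖ])

omit [ValuativeRel F] in
/-- `[[0,1],[−1,0]] · [[0,−1],[1,0]] = 1` (`J♯⁻¹ = −J♯`). [cite: Jacobowitz1962, §4] -/
theorem sharp'_mul_sharp_eq_one : (!![(0 : F), 1; -1, 0] : Matrix (Fin 2) (Fin 2) F) * !![0, -1; 1, 0] = 1 := by
  ext i j; fin_cases i <;> fin_cases j <;> simp [Matrix.mul_apply, Fin.sum_univ_two]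

omit [ValuativeRel F] in
include hD in
/-- **`ᵗσ(D) J₀ D = (−ϖ) • J♯`** for `D = diag(1, ϖ)`, `σϖ = −ϖ` (B-p12 (g29) 10:33:18Z): `D` is NOT a similitude of `J₀` at a ramified place. [cite: Jacobowitz1962, §8] [cite: Kottwitz1988, §2] -/
theorem formCongr_diag_eq_neg_smul_sharp (hσϖ : σ ϖ = -ϖ) :
    formCongr σ D (!![0, 1; 1, 0] : Matrix (Fin 2) (Fin 2) F) = (-ϖ) • (!![0, -1; 1, 0] : Matrix (Fin 2) (Fin 2) F) := by
  rw [formCongr, hD]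
  ext i j
  fin_cases i <;> fin_cases j <;> simp [Matrix.mul_apply, Fin.sum_univ_two, hσϖ]

omit [ValuativeRel F] in
include hD in
/-- **`D g D⁻¹ ∈ U(σ, J₀) ↔ g ∈ U(σ, J♯)`** (`ϖ ≠ 0`; ★ `conj_mem_unitaryGroupOfForm_iff` + `U((−ϖ)•J♯) = U(J♯)`): `Ad(D)` carries the unitary group of `J♯` onto that of `J₀`,
and `GL₂(𝒪) ∩ U(J♯)` onto the vertex stabiliser `K♯`. [cite: Kottwitz1988, §2] [cite: Jacobowitz1962, §8] -/
theorem conj_mem_unitary_swap_iff_mem_unitary_sharp (hσϖ : σ ϖ = -ϖ) (hϖ0 : ϖ ≠ 0) (g : GL (Fin 2) F) :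
    D * g * D⁻¹ ∈ unitaryGroupOfForm σ (!![0, 1; 1, 0] : Matrix (Fin 2) (Fin 2) F) ↔ g ∈ unitaryGroupOfForm σ (!![0, -1; 1, 0] : Matrix (Fin 2) (Fin 2) F) := by
  rw [conj_mem_unitaryGroupOfForm_iff, formCongr_diag_eq_neg_smul_sharp σ D hD hσϖ,
    unitaryGroupOfForm_smul_of_isUnit σ (isUnit_iff_ne_zero.2 (neg_ne_zero.2 hϖ0))]

omit [ValuativeRel F] in
/-- `↑(D⁻¹ x D) = ↑D⁻¹ ↑x ↑D`. [cite: Kottwitz1988, §2] -/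
theorem coe_inv_mul_mul_eq (x : GL (Fin 2) F) :
    (((D⁻¹ * x * D : GL (Fin 2) F)) : Matrix (Fin 2) (Fin 2) F) = ((D⁻¹ : GL (Fin 2) F) : Matrix (Fin 2) (Fin 2) F) * (x : Matrix (Fin 2) (Fin 2) F) * (D : Matrix (Fin 2) (Fin 2) F) := by
  rw [Units.val_mul, Units.val_mul]

omit [ValuativeRel F] in
/-- **`D⁻¹ · (c(1 + t · D N D⁻¹)) · D = c(1 + t N)`** for any matrix `N` and scalars `c, t`. [cite: Jacobowitz1962, §4] -/
theorem inv_conj_smul_one_add_smul_conj (c t : F) (N : Matrix (Fin 2) (Fin 2) F) :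
    ((D⁻¹ : GL (Fin 2) F) : Matrix (Fin 2) (Fin 2) F) * (c • ((1 : Matrix (Fin 2) (Fin 2) F) + t • ((D : Matrix (Fin 2) (Fin 2) F) * N * ((D⁻¹ : GL (Fin 2) F) : Matrix (Fin 2) (Fin 2) F)))) *
        (D : Matrix (Fin 2) (Fin 2) F) = c • ((1 : Matrix (Fin 2) (Fin 2) F) + t • N) := by
  have h1 : ((D⁻¹ : GL (Fin 2) F) : Matrix (Fin 2) (Fin 2) F) * (D : Matrix (Fin 2) (Fin 2) F) = 1 := by rw [← Units.val_mul, inv_mul_cancel, Units.val_one]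
  have hconj : ((D⁻¹ : GL (Fin 2) F) : Matrix (Fin 2) (Fin 2) F) * ((D : Matrix (Fin 2) (Fin 2) F) * N * ((D⁻¹ : GL (Fin 2) F) : Matrix (Fin 2) (Fin 2) F)) * (D : Matrix (Fin 2) (Fin 2) F) = N := by
    calc ((D⁻¹ : GL (Fin 2) F) : Matrix (Fin 2) (Fin 2) F) * ((D : Matrix (Fin 2) (Fin 2) F) * N * ((D⁻¹ : GL (Fin 2) F) : Matrix (Fin 2) (Fin 2) F)) * (D : Matrix (Fin 2) (Fin 2) F)
        = (((D⁻¹ : GL (Fin 2) F) : Matrix (Fin 2) (Fin 2) F) * (D : Matrix (Fin 2) (Fin 2) F)) * N * (((D⁻¹ : GL (Fin 2) F) : Matrix (Fin 2) (Fin 2) F) * (D : Matrix (Fin 2) (Fin 2) F)) := by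
          simp only [Matrix.mul_assoc]
      _ = N := by rw [h1, Matrix.one_mul, Matrix.mul_one]
  rw [Matrix.mul_smul, Matrix.smul_mul, Matrix.mul_add, Matrix.add_mul, Matrix.mul_one, h1, Matrix.mul_smul, Matrix.smul_mul, hconj]

omit [ValuativeRel F] in
/-- Same with a minus sign: `D⁻¹ · (c(1 − t · D N D⁻¹)) · D = c(1 − t N)`. [cite: Jacobowitz1962, §4] -/
theorem inv_conj_smul_one_sub_smul_conj (c t : F) (N : Matrix (Fin 2) (Fin 2) F) :
    ((D⁻¹ : GL (Fin 2) F) : Matrix (Fin 2) (Fin 2) F) * (c • ((1 : Matrix (Fin 2) (Fin 2) F) - t • ((D : Matrix (Fin 2) (Fin 2) F) * N * ((D⁻¹ : GL (Fin 2) F) : Matrix (Fin 2) (Fin 2) F)))) *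
        (D : Matrix (Fin 2) (Fin 2) F) = c • ((1 : Matrix (Fin 2) (Fin 2) F) - t • N) := by
  have h := inv_conj_smul_one_add_smul_conj D c (-t) N
  simp only [neg_smul, ← sub_eq_add_neg] at h
  exact h

end Sharp

/-! ## §2 The scalar law with the conjugated level -/

section Scalar

variable (σ : F →+* F) {ϖ : F} (J : Matrix (Fin 2) (Fin 2) F) (D : GL (Fin 2) F)

/-- **DEPTH `≥ m` AT THE VERTEX ⟹ `φ k = φ(c·1)`**: if `ϖ^{−m}(↑(D⁻¹kD) − c·1)` is integral then `k = (c·1)·y` with `↑(D⁻¹yD) − 1 = c⁻¹(↑(D⁻¹kD) − c·1)` of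
conjugated level `m`, hence `y ∈ Km` (DATA + the CONJUGATED entrywise membership) and `φ k = φ xm` by right-`Km`-invariance.  VERTEX twin of ★
`apply_eq_apply_scalar_of_depth_le`. [cite: Rogawski1990, §4.9 Lemma 4.9.3 p. 56] [cite: LabesseLanglands1979, §2] -/
theorem apply_eq_apply_scalar_of_depth_le_conj {c : F} (hc1 : valuation F c = 1) (m : ℕ) (Km : Subgroup ↥(unitaryGroupOfForm σ J))
    (hKm : ∀ y : ↥(unitaryGroupOfForm σ J),
      (∀ r s, ϖ ^ (-(m : ℤ)) * ((((D⁻¹ * (y : GL (Fin 2) F) * D : GL (Fin 2) F)) : Matrix (Fin 2) (Fin 2) F) - 1) r s ∈ 𝒪[F]) → y ∈ Km)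
    {E : Type*} (φ : ↥(unitaryGroupOfForm σ J) → E) (hφm : ∀ x, ∀ y ∈ Km, φ (x * y) = φ x)
    (xm : ↥(unitaryGroupOfForm σ J)) (hxm' : (((xm : GL (Fin 2) F)⁻¹ : GL (Fin 2) F) : Matrix (Fin 2) (Fin 2) F) = c⁻¹ • (1 : Matrix (Fin 2) (Fin 2) F))
    (k : ↥(unitaryGroupOfForm σ J))
    (hkm : ∀ r s, ϖ ^ (-(m : ℤ)) * ((((D⁻¹ * (k : GL (Fin 2) F) * D : GL (Fin 2) F)) : Matrix (Fin 2) (Fin 2) F) - c • (1 : Matrix (Fin 2) (Fin 2) F)) r s ∈ 𝒪[F]) :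
    φ k = φ xm := by
  have hc0 : c ≠ 0 := fun h => by rw [h, map_zero] at hc1; exact zero_ne_one hc1
  have hcO' : c⁻¹ ∈ 𝒪[F] := (Valuation.mem_integer_iff _ _).2 (by rw [map_inv₀, hc1, inv_one])
  have hy : xm⁻¹ * k ∈ Km := by
    refine hKm _ fun r s => ?_
    have e : (((D⁻¹ * ((xm⁻¹ * k : ↥(unitaryGroupOfForm σ J)) : GL (Fin 2) F) * D : GL (Fin 2) F)) : Matrix (Fin 2) (Fin 2) F) - 1 =
        c⁻¹ • ((((D⁻¹ * (k : GL (Fin 2) F) * D : GL (Fin 2) F)) : Matrix (Fin 2) (Fin 2) F) - c • (1 : Matrix (Fin 2) (Fin 2) F)) := by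
      rw [Subgroup.coe_mul, Subgroup.coe_inv, coe_inv_mul_mul_eq, coe_inv_mul_mul_eq, Units.val_mul, hxm', Matrix.smul_mul, Matrix.one_mul, Matrix.mul_smul,
        Matrix.smul_mul, smul_sub, smul_smul, inv_mul_cancel₀ hc0, one_smul]
    rw [e, Matrix.smul_apply, smul_eq_mul, mul_left_comm]
    exact mul_mem hcO' (hkm r s)
  calc φ k = φ (xm * (xm⁻¹ * k)) := by rw [mul_inv_cancel_left]
    _ = φ xm := hφm _ _ hy

end Scalar

/-! ## §3 The signed value law at exact depth `i < m`, VERTEX piece -/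

section ValueLaw

variable (σ : F →+* F) {ϖ : F} (hϖ : IsUniformizingElement ϖ) (hσϖ : σ ϖ = -ϖ)
  (σO : 𝒪[F] →+* 𝒪[F]) (hσO : ∀ x : 𝒪[F], ((σO x : 𝒪[F]) : F) = σ x) (hσσ : ∀ x, σO (σO x) = x)
  (J : Matrix (Fin 2) (Fin 2) F) (hJ : J = !![0, 1; 1, 0])
  (D : GL (Fin 2) F) (hD : (D : Matrix (Fin 2) (Fin 2) F) = !![1, 0; 0, ϖ])

include hϖ hσϖ hσO hσσ hJ hD in
/-- **THE SIGNED VALUE LAW AT DEPTH EXACTLY `i < m`, VERTEX PIECE (tamely ramified; over ★ B-p12 `localClass_signedNormalForm_ramified_modular`).**  `k ∈ U(J₀)` with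
`k♯ := D⁻¹ k D` INTEGRAL (`k` fixes the `η`-modular lattice `D𝒪²`), `(k♯ − a)(k♯ − c) = 0` (`a, c` norm-one units, `|a − c| = |ϖ^N|`), `i < m ≤ N`, `ϖ^{−i}(k♯ − c·1)` integral
but `ϖ^{−(i+1)}(k♯ − c·1)` not, `v` spanning the `a`-eigenline of `k♯` with `|ϖ · θ♯| = 1`, `θ♯ := Σ_r σ(v_r)(J♯ v)_r`: then `i` is EVEN, `N + i + 1` is EVEN, and for
`S = (−1)^{(N+i+1)∕2+1}·c·((a − c)ϖ^{−N})·(ϖθ♯)` there is a bit `e ≤ 1`, `e = 0 ⟺ S̄` a square, with `φ k = φ (x i e)` for every `φ` invariant under `Ad K♯`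
(`K♯ = U(J₀) ∩ D GL₂(𝒪) D⁻¹`) and right-`Km` (CONJUGATED level law), the vertex elements `x j e ∈ U(J₀)` being pinned by `↑(x j e)⁻¹ = c⁻¹(1 − ϖ^j · D[[0, η^e],[0,0]]D⁻¹)`
(B-p12's rider).  [cite: LabesseLanglands1979, §2 Lemma 2.1 pp. 8–9] [cite: Rogawski1990, §4.9 Lemma 4.9.3 p. 56] [cite: Jacobowitz1962, §8] -/
theorem apply_eq_apply_signedNormalForm_of_depth_eq_ramified_modular [IsAdicComplete (IsLocalRing.maximalIdeal 𝒪[F]) 𝒪[F]] [Finite (IsLocalRing.ResidueField 𝒪[F])]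
    (h2 : IsUnit (2 : 𝒪[F])) (hres : ∀ x : 𝒪[F], σO x - x ∈ IsLocalRing.maximalIdeal 𝒪[F])
    {η : 𝒪[F]} (hηu : IsUnit η) (hση : σO η = η) (hη : ¬ IsSquare (IsLocalRing.residue 𝒪[F] η))
    {a c : F} (ha : σ a * a = 1) (hc : σ c * c = 1) (ha1 : valuation F a = 1) (hc1 : valuation F c = 1)
    {N : ℕ} (hN : valuation F (a - c) = valuation F (ϖ ^ N)) {i m : ℕ} (him : i < m) (hmN : m ≤ N)
    (Km : Subgroup ↥(unitaryGroupOfForm σ J))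
    (hKm : ∀ y : ↥(unitaryGroupOfForm σ J),
      (∀ r s, ϖ ^ (-(m : ℤ)) * ((((D⁻¹ * (y : GL (Fin 2) F) * D : GL (Fin 2) F)) : Matrix (Fin 2) (Fin 2) F) - 1) r s ∈ 𝒪[F]) → y ∈ Km)
    {E : Type*} (φ : ↥(unitaryGroupOfForm σ J) → E)
    (hφAd : ∀ κ : ↥(unitaryGroupOfForm σ J), (κ : GL (Fin 2) F) ∈ (glInt 2 F).map (MulAut.conj D).toMonoidHom → ∀ x, φ (κ * x * κ⁻¹) = φ x)
    (hφm : ∀ x, ∀ y ∈ Km, φ (x * y) = φ x)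
    (x : ℕ → ℕ → ↥(unitaryGroupOfForm σ J))
    (hx' : ∀ j e, Even j → (((x j e : GL (Fin 2) F)⁻¹ : GL (Fin 2) F) : Matrix (Fin 2) (Fin 2) F) =
      c⁻¹ • ((1 : Matrix (Fin 2) (Fin 2) F) - ϖ ^ j • ((D : Matrix (Fin 2) (Fin 2) F) * !![0, ((η : 𝒪[F]) : F) ^ e; 0, 0] * ((D⁻¹ : GL (Fin 2) F) : Matrix (Fin 2) (Fin 2) F))))
    (k : ↥(unitaryGroupOfForm σ J))
    (hkO : ∀ r s, (((D⁻¹ * (k : GL (Fin 2) F) * D : GL (Fin 2) F)) : Matrix (Fin 2) (Fin 2) F) r s ∈ 𝒪[F])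
    (hac : ((((D⁻¹ * (k : GL (Fin 2) F) * D : GL (Fin 2) F)) : Matrix (Fin 2) (Fin 2) F) - a • 1) * ((((D⁻¹ * (k : GL (Fin 2) F) * D : GL (Fin 2) F)) : Matrix (Fin 2) (Fin 2) F) - c • 1) = 0)
    (hki : ∀ r s, ϖ ^ (-(i : ℤ)) * ((((D⁻¹ * (k : GL (Fin 2) F) * D : GL (Fin 2) F)) : Matrix (Fin 2) (Fin 2) F) - c • (1 : Matrix (Fin 2) (Fin 2) F)) r s ∈ 𝒪[F])
    (hki' : ¬ ∀ r s, ϖ ^ (-((i : ℤ) + 1)) * ((((D⁻¹ * (k : GL (Fin 2) F) * D : GL (Fin 2) F)) : Matrix (Fin 2) (Fin 2) F) - c • (1 : Matrix (Fin 2) (Fin 2) F)) r s ∈ 𝒪[F])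
    (v : Fin 2 → F) (hv : ∀ z : Fin 2 → F, (((D⁻¹ * (k : GL (Fin 2) F) * D : GL (Fin 2) F)) : Matrix (Fin 2) (Fin 2) F) *ᵥ z = a • z → ∃ ξ : F, z = ξ • v)
    (hθ : valuation F (ϖ * ((fun r => σ (v r)) ⬝ᵥ (!![0, -1; 1, 0] *ᵥ v))) = 1) :
    Even i ∧ Even (N + i + 1) ∧ ∀ S : 𝒪[F],
      (S : F) = (-1) ^ ((N + i + 1) / 2 + 1) * c * ((a - c) * (ϖ ^ N)⁻¹) * (ϖ * ((fun r => σ (v r)) ⬝ᵥ (!![0, -1; 1, 0] *ᵥ v))) →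
      ∃ e : ℕ, e ≤ 1 ∧ (e = 0 ↔ IsSquare (IsLocalRing.residue 𝒪[F] S)) ∧ φ k = φ (x i e) := by
  subst hJ
  have hϖ0 : ϖ ≠ 0 := hϖ.ne_zero
  have hc0 : c ≠ 0 := fun h => by rw [h, map_zero] at hc1; exact zero_ne_one hc1
  have hcO' : c⁻¹ ∈ 𝒪[F] := (Valuation.mem_integer_iff _ _).2 (by rw [map_inv₀, hc1, inv_one])
  have hσOmem : ∀ y ∈ 𝒪[F], σ y ∈ 𝒪[F] := fun y hy => by rw [← hσO ⟨y, hy⟩]; exact (σO ⟨y, hy⟩).2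
  have hηeO : ∀ e : ℕ, ((η : 𝒪[F]) : F) ^ e ∈ 𝒪[F] := fun e => pow_mem η.2 e
  -- `k♯ := D⁻¹ k D` is `J♯`-unitary
  set kS : GL (Fin 2) F := D⁻¹ * (k : GL (Fin 2) F) * D with hkS
  have hkSU : kS ∈ unitaryGroupOfForm σ (!![0, -1; 1, 0] : Matrix (Fin 2) (Fin 2) F) := by
    rw [← conj_mem_unitary_swap_iff_mem_unitary_sharp σ D hD hσϖ hϖ0, hkS,
      show D * (D⁻¹ * (k : GL (Fin 2) F) * D) * D⁻¹ = (k : GL (Fin 2) F) by group]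
    exact k.2
  have hkU : (((kS : GL (Fin 2) F) : Matrix (Fin 2) (Fin 2) F).map σ)ᵀ * !![0, -1; 1, 0] * ((kS : GL (Fin 2) F) : Matrix (Fin 2) (Fin 2) F) = !![0, -1; 1, 0] :=
    mem_unitaryGroupOfForm_iff.1 hkSU
  -- ★ the signed window class, vertex form
  obtain ⟨heven, hev, hall⟩ := localClass_signedNormalForm_ramified_modular σ hϖ hσϖ σO hσO hσσ h2 hres hηu hση hη hkO hkU ha hc ha1 hc1 hac hN him hmN hki hki' v hv hθ
  refine ⟨heven, hev, fun S hS => ?_⟩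
  obtain ⟨κ, hκO, hκU, e, he, hiff, R, hRO, hid⟩ := hall S hS
  refine ⟨e, he, hiff, ?_⟩
  -- `κ` as an element of `GL₂(𝒪) ∩ U(J♯)`; its inverse is `J♯⁻¹ κᴴ J♯`
  have hinv : !![(0 : F), 1; -1, 0] * (κ.map σ)ᵀ * !![0, -1; 1, 0] * κ = 1 := by
    rw [Matrix.mul_assoc (!![(0 : F), 1; -1, 0] * (κ.map σ)ᵀ), Matrix.mul_assoc !![(0 : F), 1; -1, 0], ← Matrix.mul_assoc ((κ.map σ)ᵀ), hκU,
      sharp'_mul_sharp_eq_one]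
  have hinv' : κ * (!![(0 : F), 1; -1, 0] * (κ.map σ)ᵀ * !![0, -1; 1, 0]) = 1 := mul_eq_one_comm.1 hinv
  let κG : GL (Fin 2) F := ⟨κ, !![(0 : F), 1; -1, 0] * (κ.map σ)ᵀ * !![0, -1; 1, 0], hinv', hinv⟩
  have hκGU : κG ∈ unitaryGroupOfForm σ (!![0, -1; 1, 0] : Matrix (Fin 2) (Fin 2) F) := mem_unitaryGroupOfForm_iff.2 hκU
  have hκinvO : ∀ r s, ((!![(0 : F), 1; -1, 0] * (κ.map σ)ᵀ * !![0, -1; 1, 0] : Matrix (Fin 2) (Fin 2) F)) r s ∈ 𝒪[F] := by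
    intro r s
    have hent : ∀ r' s', ((κ.map σ)ᵀ) r' s' ∈ 𝒪[F] := fun r' s' => by
      rw [Matrix.transpose_apply, Matrix.map_apply]; exact hσOmem _ (hκO _ _)
    have hL : ∀ r' s', ((!![(0 : F), 1; -1, 0] : Matrix (Fin 2) (Fin 2) F)) r' s' ∈ 𝒪[F] := by
      intro r' s'; fin_cases r' <;> fin_cases s' <;> simp
    have hR : ∀ r' s', ((!![(0 : F), -1; 1, 0] : Matrix (Fin 2) (Fin 2) F)) r' s' ∈ 𝒪[F] := by
      intro r' s'; fin_cases r' <;> fin_cases s' <;> simp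
    exact mul_apply_mem_integer (fun r' s' => mul_apply_mem_integer hL hent r' s') hR r s
  have hκGint : κG ∈ glInt 2 F := (mem_glInt_iff κG).2 ⟨hκO, hκinvO⟩
  -- `κ′ := D κ D⁻¹ ∈ K♯ ⊆ U(J₀)`
  have hκ'U : D * κG * D⁻¹ ∈ unitaryGroupOfForm σ (!![0, 1; 1, 0] : Matrix (Fin 2) (Fin 2) F) :=
    (conj_mem_unitary_swap_iff_mem_unitary_sharp σ D hD hσϖ hϖ0 κG).2 hκGU
  set κU : ↥(unitaryGroupOfForm σ (!![0, 1; 1, 0] : Matrix (Fin 2) (Fin 2) F)) := ⟨D * κG * D⁻¹, hκ'U⟩ with hκUdef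
  have hκUsharp : (κU : GL (Fin 2) F) ∈ (glInt 2 F).map (MulAut.conj D).toMonoidHom := by
    rw [mem_map_conj_glInt_iff, hκUdef]
    show D⁻¹ * (D * κG * D⁻¹) * D ∈ glInt 2 F
    rw [show D⁻¹ * (D * κG * D⁻¹) * D = κG by group]
    exact hκGint
  -- `z := κ′⁻¹ k κ′` has `D⁻¹ z D = κ⁻¹ k♯ κ`, in normal form
  have hz : (((D⁻¹ * ((κU⁻¹ * k * κU : ↥(unitaryGroupOfForm σ (!![0, 1; 1, 0] : Matrix (Fin 2) (Fin 2) F))) : GL (Fin 2) F) * D : GL (Fin 2) F)) : Matrix (Fin 2) (Fin 2) F) =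
      c • ((1 : Matrix (Fin 2) (Fin 2) F) + ϖ ^ i • !![0, ((η : 𝒪[F]) : F) ^ e; 0, 0]) + ϖ ^ m • R := by
    have hg : D⁻¹ * ((κU⁻¹ * k * κU : ↥(unitaryGroupOfForm σ (!![0, 1; 1, 0] : Matrix (Fin 2) (Fin 2) F))) : GL (Fin 2) F) * D = κG⁻¹ * kS * κG := by
      rw [Subgroup.coe_mul, Subgroup.coe_mul, Subgroup.coe_inv, hκUdef, hkS]
      show D⁻¹ * ((D * κG * D⁻¹)⁻¹ * (k : GL (Fin 2) F) * (D * κG * D⁻¹)) * D = κG⁻¹ * (D⁻¹ * (k : GL (Fin 2) F) * D) * κG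
      group
    rw [hg, Units.val_mul, Units.val_mul, Matrix.coe_units_inv, ← hid]
    show κ⁻¹ * ((kS : GL (Fin 2) F) : Matrix (Fin 2) (Fin 2) F) * κ = _
    rw [Matrix.inv_eq_left_inv hinv]
  -- `y := (x i e)⁻¹ z` has conjugated level `m`
  have hy : (x i e)⁻¹ * (κU⁻¹ * k * κU) ∈ Km := by
    refine hKm _ fun r s => ?_
    have hsplit : D⁻¹ * (((x i e)⁻¹ * (κU⁻¹ * k * κU) : ↥(unitaryGroupOfForm σ (!![0, 1; 1, 0] : Matrix (Fin 2) (Fin 2) F))) : GL (Fin 2) F) * D =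
        (D⁻¹ * ((x i e : GL (Fin 2) F)⁻¹) * D) * (D⁻¹ * ((κU⁻¹ * k * κU : ↥(unitaryGroupOfForm σ (!![0, 1; 1, 0] : Matrix (Fin 2) (Fin 2) F))) : GL (Fin 2) F) * D) := by
      rw [Subgroup.coe_mul, Subgroup.coe_inv]; group
    have hxconj : (((D⁻¹ * ((x i e : GL (Fin 2) F)⁻¹) * D : GL (Fin 2) F)) : Matrix (Fin 2) (Fin 2) F) =
        c⁻¹ • ((1 : Matrix (Fin 2) (Fin 2) F) - ϖ ^ i • !![0, ((η : 𝒪[F]) : F) ^ e; 0, 0]) := by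
      rw [coe_inv_mul_mul_eq, hx' i e heven, inv_conj_smul_one_sub_smul_conj]
    have hxy : (((D⁻¹ * (((x i e)⁻¹ * (κU⁻¹ * k * κU) : ↥(unitaryGroupOfForm σ (!![0, 1; 1, 0] : Matrix (Fin 2) (Fin 2) F))) : GL (Fin 2) F) * D : GL (Fin 2) F)) : Matrix (Fin 2) (Fin 2) F) - 1 =
        ϖ ^ m • ((c⁻¹ • ((1 : Matrix (Fin 2) (Fin 2) F) - ϖ ^ i • !![0, ((η : 𝒪[F]) : F) ^ e; 0, 0])) * R) := by
      rw [hsplit, Units.val_mul, hxconj, hz, Matrix.mul_add, Matrix.smul_mul, Matrix.mul_smul, Matrix.mul_smul, smul_smul, inv_mul_cancel₀ hc0, one_smul,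
        one_sub_smul_nil_mul_one_add_smul_nil, add_sub_cancel_left, Matrix.smul_mul]
    rw [hxy, Matrix.smul_apply, smul_eq_mul, ← mul_assoc, ← zpow_natCast, ← zpow_add₀ hϖ0, neg_add_cancel, zpow_zero, one_mul]
    refine mul_apply_mem_integer (fun r s => ?_) hRO r s
    fin_cases r <;> fin_cases s <;>
      simp only [Matrix.smul_apply, Matrix.sub_apply, Matrix.one_apply, Matrix.of_apply, Matrix.cons_val', Matrix.cons_val_zero, Matrix.cons_val_one,
        Matrix.cons_val_fin_one, Fin.zero_eta, Fin.mk_one, smul_eq_mul, Fin.isValue, if_true, one_ne_zero, zero_ne_one, if_false, mul_zero, sub_zero, zero_sub,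
        mul_one, mul_neg] <;>
      first | exact hcO' | exact zero_mem _ | exact neg_mem (mul_mem hcO' (mul_mem (pow_mem hϖ.mem i) (hηeO e)))
  -- assemble: `k = κ′ · (x_i^e · y) · κ′⁻¹`
  have hk : k = κU * (x i e * ((x i e)⁻¹ * (κU⁻¹ * k * κU))) * κU⁻¹ := by group
  rw [hk, hφAd κU hκUsharp, hφm _ _ hy]

end ValueLaw

end Literature.NumberTheory.Automorphic

end
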